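import Summits.ResolutionOfSingularities.ResolutionOfSingularities.Theses.FoliationDescent
import Literature.AlgebraicGeometry.Resolution.TameQuotientSingularitiesResolution
import Summits.ResolutionOfSingularities.ResolutionOfSingularities.Theorems.FoliationDescentLogCanQuotLUConstantsFG
import Summits.ResolutionOfSingularities.ResolutionOfSingularities.Theorems.FoliationDescentLogCanQuotLUNonsingularDescent
import Summits.ResolutionOfSingularities.ResolutionOfSingularities.Theorems.FoliationDescentLogCanQuotLUMultiplicativeShrink
import Summits.ResolutionOfSingularities.ResolutionOfSingularities.Theorems.FoliationDescentLogCanQuotLUPCyclicGrading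
import Summits.ResolutionOfSingularities.ResolutionOfSingularities.Theorems.FoliationDescentLogCanQuotLUTwistedRootAlgebra
import Summits.ResolutionOfSingularities.ResolutionOfSingularities.Theorems.FoliationDescentLogCanQuotLUHasResolutionOfChart
import Summits.ResolutionOfSingularities.ResolutionOfSingularities.Theorems.FoliationDescentLogCanQuotLUResolutionToConstantsModel
import Summits.ResolutionOfSingularities.ResolutionOfSingularities.Theorems.LogCanQuotLU.Negative.Transport
import HarnessLib

/-!
# Crux `LogCanQuotLU` (stmt-ResolutionOfSingularities-17082) from Bergh–Rydh 2019, Thm 5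

Route `ResolutionOfSingularities/FoliationDescent`, crux
`Summit.ResolutionOfSingularities.ResolutionOfSingularities.Theses.FoliationDescent.LogCanQuotLU`
("log-canonical quotients uniformize"), line `birth` (lead
prover-line-stmt-ResolutionOfSingularities-17082-0). This file is the line's skeleton
(`Cruxes/LogCanQuotLU/Lines/birth.lean`, RESHAPE 2) with every stub replaced by its LANDED proof; the
only input that is not proved in the tree is the NAMED FACT
`Literature.AlgebraicGeometry.Resolution.BerghRydh2019_diagonalizableQuotientResolution`
(D. Bergh, D. Rydh, arXiv:1905.00872, Thm 5, diagonalizable case — a published theorem), taken as a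
hypothesis. Hence the crux is CLOSED MODULO BERGH–RYDH:

* `stub_twistedChart` (the registered stub of RESHAPE 1, PROVED) — the twisted `μ_p`-grading chart
  over the constants of a regular `E`-stable model in the multiplicative case
  (`stub_twistedRootAlgebra` + `stub_pCyclicGrading`, transported along the equality of carriers
  `S_0 = ker θ`);
* `multiplicativeToricLU` — birth's multiplicative stub, GRANTED Bergh–Rydh: shrink
  (`stub_multiplicativeShrink`), constants (`stub_constantsFG`), chart (`stub_twistedChart`), resolution of
  `Spec C` (`stub_hasResolutionOfChart` + the fact), local uniformization of `K^D` along `O` above `C`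
  (`stub_resolutionToConstantsModel`);
* `logCanQuotLU_of_berghRydh2019 : BerghRydh2019_diagonalizableQuotientResolution → LogCanQuotLU` —
  the case split of the crux: non-singular (`stub_nonsingularDescent` on `A := S'^D`) or
  multiplicative (`multiplicativeToricLU`).

Axioms of everything here: `propext`, `Classical.choice`, `Quot.sound`; trust base of
`logCanQuotLU_of_berghRydh2019`: the single named fact.
-/

noncomputable section

-- single-problem summit: the doubled namespace component `ResolutionOfSingularities` is forced
set_option linter.dupNamespace false

open Summit.ResolutionOfSingularities.ResolutionOfSingularities.Theses.FoliationDescent (LogCanQuotLU)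

namespace Summit.ResolutionOfSingularities.ResolutionOfSingularities.Theorems

namespace LogCanQuotLUOfBerghRydh

/-- **The eigenvalue of a multiplicative derivation is a constant**: if `E ≠ 0` and `E^[p] = u · E`
pointwise then `E u = 0` (apply `E` to `E^[p] x₀ = u · E x₀` with `E x₀ ≠ 0`, using
`E ∘ E^[p] = E^[p] ∘ E`). (= `Disproof.apply_eq_zero_of_iterate_eq_mul`.) [folklore] -/
theorem apply_eigenvalue_eq_zero {k K : Type} [Field k] [Field K] [Algebra k K] {p : ℕ}
    (E : Derivation k K K) (u : K) (hE : ∀ x : K, (⇑E)^[p] x = u * E x) (hE0 : E ≠ 0) :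
    E u = 0 := by
  obtain ⟨x₀, hx₀⟩ : ∃ x₀ : K, E x₀ ≠ 0 := by
    by_contra h
    exact hE0 (Derivation.ext fun x => by simpa using not_exists.mp h x)
  have h1 : (⇑E)^[p] (E x₀) = E ((⇑E)^[p] x₀) := by
    rw [← Function.iterate_succ_apply, Function.iterate_succ_apply']
  rw [hE (E x₀), hE x₀, Derivation.leibniz, smul_eq_mul, smul_eq_mul] at h1
  have h2 : E x₀ * E u = 0 := by linear_combination -h1
  exact (mul_eq_zero.mp h2).resolve_left hx₀

end LogCanQuotLUOfBerghRydh

open LogCanQuotLUOfBerghRydh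

/-- **The twisted `μ_p`-grading chart** (birth's `stub_twistedChart`, PROVED): for a regular finitely
generated `T ≤ K` stable under `E` with `E^p = uE`, `u ∈ T^×`, `E u = 0`, and `C = T ∩ ker E`, there is
a finite-type regular `k`-algebra graded by a finite abelian group whose degree-`0` part is an étale
`C`-algebra lying over every prime of `C`: the root algebra `S = T[ω]/(ω^{p-1} - u⁻¹)` with its
`p`-cyclic derivation `θ = ωE` (`stub_twistedRootAlgebra`) graded by `ZMod p` (`stub_pCyclicGrading`);
the étale structure of `ker θ` is moved to the degree-`0` piece along the equality of carriers.
[cite: BerghRydh2019, Thm 5 and the definition preceding it] -/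
theorem stub_twistedChart :
  ∀ p : ℕ, p.Prime → ∀ (k K : Type) [Field k] [CharP k p] [Field K] [Algebra k K]
    (T : Subalgebra k K) (E : Derivation k K K) (u : K) (C : Subalgebra k K),
    T.FG → IsRegularRing T → (∀ x ∈ T, E x ∈ T) → u ∈ T → u⁻¹ ∈ T → u ≠ 0 →
    (∀ x : K, (⇑E)^[p] x = u * E x) → E u = 0 →
    (∀ x : K, x ∈ C ↔ (x ∈ T ∧ E x = 0)) →
    ∃ (A : Type) (_ : AddCommGroup A) (_ : Finite A) (_ : DecidableEq A) (S : Type)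
      (_ : CommRing S) (_ : Algebra k S) (𝒮 : A → Submodule k S) (_ : GradedAlgebra 𝒮),
      Algebra.FiniteType k S ∧ IsRegularRing S ∧
      ∃ (_ : Algebra C (𝒮 0)) (_ : IsScalarTower k C (𝒮 0)), Algebra.Etale C (𝒮 0) ∧
        ∀ P : Ideal C, P.IsPrime →
          ∃ Q : Ideal (𝒮 0), Q.IsPrime ∧ Q.comap (algebraMap C (𝒮 0)) = P := by
  intro p hp k K _ _ _ _ T E u C hTfg hTreg hpres hu huinv hu0 hmul hEu hC
  haveI : Fact p.Prime := ⟨hp⟩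
  obtain ⟨S, _, _, hSft, hSreg, θ, hθp, hZ⟩ :=
    stub_twistedRootAlgebra p hp k K T E u C hTfg hTreg hpres hu huinv hu0 hmul hEu hC
  obtain ⟨𝒮, _, hmem⟩ := stub_pCyclicGrading p k S θ hθp
  -- the subalgebra `Z = ker θ`
  let Z : Subalgebra k S :=
    { carrier := {s | θ s = 0}
      mul_mem' := fun {a b} ha hb => by
        simp only [Set.mem_setOf_eq] at ha hb ⊢
        rw [Derivation.leibniz, ha, hb, smul_zero, smul_zero, add_zero]
      one_mem' := by simp
      add_mem' := fun {a b} ha hb => by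
        simp only [Set.mem_setOf_eq] at ha hb ⊢
        rw [map_add, ha, hb, add_zero]
      zero_mem' := by simp
      algebraMap_mem' := fun c => by simp }
  have hZmem : ∀ s : S, s ∈ Z ↔ θ s = 0 := fun s => Iff.rfl
  obtain ⟨_, _, het, hsurj⟩ := hZ Z hZmem
  -- `𝒮 0` and `Z` have the same elements
  have h0 : ∀ s : S, s ∈ 𝒮 0 ↔ s ∈ Z := fun s => by
    rw [hmem, map_zero, zero_smul]
    rfl
  let e : 𝒮 0 ≃+* Z :=
    { toFun := fun s => ⟨s.1, (h0 _).1 s.2⟩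
      invFun := fun s => ⟨s.1, (h0 _).2 s.2⟩
      left_inv := fun s => rfl
      right_inv := fun s => rfl
      map_mul' := fun a b => Subtype.ext (by simp)
      map_add' := fun a b => Subtype.ext (by simp) }
  letI alg : Algebra C (𝒮 0) := (e.symm.toRingHom.comp (algebraMap C Z)).toAlgebra
  have halg : ∀ c : C, algebraMap C (𝒮 0) c = e.symm (algebraMap C Z c) := fun c => rfl
  haveI : IsScalarTower k C (𝒮 0) := by
    refine IsScalarTower.of_algebraMap_eq fun c => ?_
    apply Subtype.ext
    rw [halg]
    change ((algebraMap k (𝒮 0) c : 𝒮 0) : S) = ((algebraMap C Z (algebraMap k C c) : Z) : S)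
    rw [← IsScalarTower.algebraMap_apply k C Z c, SetLike.GradeZero.coe_algebraMap]
    rfl
  let e' : Z ≃ₐ[C] 𝒮 0 :=
    { e.symm with
      commutes' := fun c => rfl }
  haveI : Algebra.Etale C Z := het
  refine ⟨ZMod p, inferInstance, inferInstance, inferInstance, S, ‹_›, ‹_›, 𝒮, ‹_›, hSft, hSreg,
    alg, ‹_›, Algebra.Etale.of_equiv e', fun P hP => ?_⟩
  obtain ⟨Q, hQ, hQP⟩ := hsurj P hP
  refine ⟨Q.comap (e : 𝒮 0 →+* Z), Ideal.comap_isPrime _ _, ?_⟩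
  have hcomp : (e : 𝒮 0 →+* Z).comp (algebraMap C (𝒮 0)) = algebraMap C Z :=
    RingHom.ext fun c => e.apply_symm_apply _
  rw [Ideal.comap_comap, hcomp, hQP]


/-- **Birth's multiplicative stub, granted Bergh–Rydh** (`Sig.stub_multiplicativeToricLU` of the
skeleton): in the multiplicative case the constants `S'^D` are dominated, inside `O ∩ K^D`, by a
finitely generated algebra of constants regular at the centre of `O`. Shrink to a regular `g•D`-stable
`S''` (`stub_multiplicativeShrink`), take its constants `C` (`stub_constantsFG`), build the twisted
`μ_p`-chart over `C` (`stub_twistedChart`), resolve `Spec C` (`stub_hasResolutionOfChart`, using the named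
fact), and uniformize `K^D` along `O` above `C ⊇ S'^D` (`stub_resolutionToConstantsModel`).
[cite: BerghRydh2019, Thm 5] -/
theorem multiplicativeToricLU
    (hBR : Literature.AlgebraicGeometry.Resolution.BerghRydh2019_diagonalizableQuotientResolution) :
  ∀ p : ℕ, p.Prime → ∀ (k K : Type) [Field k] [CharP k p] [PerfectField k] [Field K] [Algebra k K]
    (O : ValuationSubring K) (S' : Subalgebra k K) (h' : S'.toSubring ≤ O.toSubring)
    (D : Derivation k K K) (g : K),
    S'.FG → IsFractionRing S' K →
    IsRegularLocalRing
      (Localization.AtPrime (Ideal.comap (Subring.inclusion h') (IsLocalRing.maximalIdeal O))) →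
    D ≠ 0 → (∃ c : K, ∀ x : K, (⇑D)^[p] x = c * D x) → g ≠ 0 →
    (∀ x : K, (∃ a b : K, a ∈ S' ∧ b ∈ S' ∧ b ≠ 0 ∧ b⁻¹ ∈ O ∧ x = a / b) →
      ∃ a b : K, a ∈ S' ∧ b ∈ S' ∧ b ≠ 0 ∧ b⁻¹ ∈ O ∧ (g • D) x = a / b) →
    (∃ u : K, (∃ a b : K, a ∈ S' ∧ b ∈ S' ∧ b ≠ 0 ∧ b⁻¹ ∈ O ∧ u = a / b) ∧ u ≠ 0 ∧ u⁻¹ ∈ O ∧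
      ∀ x : K, (⇑(g • D))^[p] x = u * (g • D) x) →
    ∃ (A : Subalgebra k K) (hA : A.toSubring ≤ O.toSubring),
      (∀ x ∈ S', D x = 0 → x ∈ A) ∧ A.FG ∧ (∀ x ∈ A, D x = 0) ∧
      IsRegularLocalRing
        (Localization.AtPrime (Ideal.comap (Subring.inclusion hA) (IsLocalRing.maximalIdeal O))) := by
  intro p hp k K _ _ _ _ _ O S' h' D g hS'fg hS'frac hreg hD _hpc hg hpres hmu
  -- (3a) shrink to a regular, `g•D`-stable `S'' ⊆ O` containing `u^{±1}`
  obtain ⟨S'', u, hle, h''O, h''fg, h''reg, h''pres, huS, huinvS, hu0, hmul⟩ :=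
    stub_multiplicativeShrink p hp k K O S' h' D g hS'fg hS'frac hreg hpres hmu
  -- (stub 1) the constants `C = S'' ∩ ker D`, finitely generated, with `Frac C = K^D`
  have hS''frac : IsFractionRing S'' K := LogCanQuotLU.Negative.isFractionRing_of_le hle hS'frac
  obtain ⟨C, hCchar, hCfg, hCfrac⟩ := stub_constantsFG p hp k K S'' D h''fg hS''frac
  -- `E := g • D`; its eigenvalue is a constant, and `C = S'' ∩ ker E`
  have hE0 : g • D ≠ 0 := by
    intro h0
    apply hD
    ext x
    have hx : (g • D) x = 0 := by rw [h0]; rfl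
    rw [Derivation.smul_apply, smul_eq_mul, mul_eq_zero] at hx
    simpa using hx.resolve_left hg
  have hEu : (g • D) u = 0 := apply_eigenvalue_eq_zero (g • D) u hmul hE0
  have hCchar' : ∀ x : K, x ∈ C ↔ (x ∈ S'' ∧ (g • D) x = 0) := by
    intro x
    rw [hCchar x, Derivation.smul_apply, smul_eq_mul, mul_eq_zero]
    exact ⟨fun ⟨h1, h2⟩ => ⟨h1, Or.inr h2⟩, fun ⟨h1, h2⟩ => ⟨h1, h2.resolve_left hg⟩⟩
  -- (3b) the twisted `μ_p`-chart over `C`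
  obtain ⟨A, _, _, _, S, _, _, 𝒮, _, hSft, hSreg, _, _, hSet, hSurj⟩ :=
    stub_twistedChart p hp k K S'' (g • D) u C h''fg h''reg h''pres huS huinvS hu0 hmul hEu hCchar'
  -- (3d + BR) resolution of `Spec C`
  have hCft : Algebra.FiniteType k C := C.fg_iff_finiteType.mp hCfg
  have hres : Literature.AlgebraicGeometry.Resolution.Scheme.HasResolution
      (AlgebraicGeometry.Spec (CommRingCat.of C)) :=
    stub_hasResolutionOfChart hBR k C hCft
      ⟨A, ‹_›, ‹_›, ‹_›, S, ‹_›, ‹_›, 𝒮, ‹_›, hSft, hSreg, ‹_›, ‹_›, hSet, hSurj⟩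
  -- (3c) uniformize `K^D` along `O` above `C`
  have hCO : C.toSubring ≤ O.toSubring := fun x hx => h''O (((hCchar x).1 hx).1 : x ∈ S'')
  have hCconst : ∀ x ∈ C, D x = 0 := fun x hx => ((hCchar x).1 hx).2
  obtain ⟨A', hA', hCA', hA'fg, hA'const, hA'reg⟩ :=
    stub_resolutionToConstantsModel k K O D C hCO hCfg hCconst hCfrac hres
  refine ⟨A', hA', fun x hxS' hDx => hCA' ((hCchar x).2 ⟨hle hxS', hDx⟩), hA'fg, hA'const, hA'reg⟩


/-- **The crux `LogCanQuotLU` modulo Bergh–Rydh 2019, Thm 5**: granted the named fact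
`BerghRydh2019_diagonalizableQuotientResolution` (resolution of finite diagonalizable quotient
singularities over perfect fields — published, recorded in the tree, not yet formalised), log-canonical
quotients uniformize: `stub_constantsFG` produces `A₀ = S'^D` (f.g., `Frac A₀ = K^D`, `R ≤ A₀`); in
the NON-SINGULAR case `A := A₀` is regular at the centre (`stub_nonsingularDescent`); in the
MULTIPLICATIVE case `A :=` the algebra of `multiplicativeToricLU` (it contains `A₀ ⊇ R`, hence
`Frac A = K^D`). CONDITIONAL: the trust base is exactly the named fact. [cite: BerghRydh2019, Thm 5] -/
theorem logCanQuotLU_of_berghRydh2019 :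
    Literature.AlgebraicGeometry.Resolution.BerghRydh2019_diagonalizableQuotientResolution →
      LogCanQuotLU := by
  intro hBR p hp k K _ _ _ _ _ O S' h' D g R hS'fg hS'frac hreg hD hpc hg hpres hcase _hRfg hRle hRconst
  obtain ⟨A₀, hchar, hA₀fg, hA₀frac⟩ := stub_constantsFG p hp k K S' D hS'fg hS'frac
  have hA₀S' : ∀ x : K, x ∈ A₀ → x ∈ S' := fun x hx => ((hchar x).1 hx).1
  have hA₀D : ∀ x : K, x ∈ A₀ → D x = 0 := fun x hx => ((hchar x).1 hx).2
  have hA₀O : A₀.toSubring ≤ O.toSubring := by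
    intro x hx
    exact h' (show x ∈ S'.toSubring from hA₀S' x hx)
  have hRA₀ : R ≤ A₀ := fun x hx => (hchar x).2 ⟨hRle hx, hRconst x hx⟩
  rcases hcase with hns | hmu
  · exact ⟨A₀, hA₀O, hRA₀, hA₀fg, hA₀D, hA₀frac,
      stub_nonsingularDescent p hp k K O S' h' D g A₀ hA₀O hS'fg hS'frac hreg hD hpc hg hpres hns hchar⟩
  · obtain ⟨A, hA, hdom, hAfg, hAconst, hAreg⟩ :=
      multiplicativeToricLU hBR p hp k K O S' h' D g hS'fg hS'frac hreg hD hpc hg hpres hmu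
    refine ⟨A, hA, fun x hx => hdom x (hRle hx) (hRconst x hx), hAfg, hAconst, ?_, hAreg⟩
    intro x hDx
    obtain ⟨a, b, ha, hb, hb0, hx⟩ := hA₀frac x hDx
    exact ⟨a, b, hdom a (hA₀S' a ha) (hA₀D a ha), hdom b (hA₀S' b hb) (hA₀D b hb), hb0, hx⟩


end Summit.ResolutionOfSingularities.ResolutionOfSingularities.Theorems

end
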